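import Literature.ModelTheory.ExponentialFields.CharbonnelClosureLemma
import Mathlib.Analysis.Normed.Operator.Banach
import Mathlib.Topology.Algebra.Module.FiniteDimension
import HarnessLib

/-!
# The Charbonnel closure of the exponential varieties is uniformly tame (normal forms)

Topic `Literature/ModelTheory/ExponentialFields`.  J.-Y. Charbonnel (*Sur certains sous-ensembles
de l'espace euclidien*, Ann. Inst. Fourier 41 (1991), §§1–2) closes the projections of zero sets of
exponential polynomials under finite unions, intersections, projections **and topological
closure** (the classes `P_{n,k}`, `k` = closure depth) and proves, by induction on `k`, that every
set so obtained has finitely many connected components, uniformly in fibres (Lemme 2.5,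
Corollaire 2.6; the induction step is Lemme 2.4).  This is the o-minimality of the *Charbonnel
closure* `𝒮̃` of the weak structure of exponential varieties (A. J. Wilkie, Selecta Math. 5 (1999),
Thm. 2.1; A. Fornasiero, T. Servi, Fund. Math. 209 (2010), Def. 7.3 and Thm. 7.4), the first
input of Wilkie's theorem of the complement.  This file proves it for the zero sets of
`L_exp`-terms over `ℝ`, in a parametric normal form:

* `NF m k n` — **parametric normal forms of closure depth `k`** (`m` real parameters, `n`
  coordinates): depth `0` = a term `t(p, x)` (the family `p ↦ Z(t(p, ·))`); depth `k + 1` = a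
  finite list (union) of *closure items* `(D, N, ι, τ, C)` with `C : NF m k D`, `ι : Fin N ↪ Fin D`,
  `τ : Fin N ↠ Fin n`, denoting `{x | x ∘ τ ∈ cl(π_ι C(p))}` (Charbonnel's normal form of
  Lemme 2.2 (ii), rearranged by the product trick `⋂ᵢ cl(πᵢ Cᵢ) ≅ cl(π ∏ᵢ Cᵢ) ∩ Δ`);
* the operations `mapParams`, `perm`, `cylRight`, `cylLeft`, `lift`, `ofTerm`, `union`, `inter`
  (products of items), `closureItem`, each with its semantics (`NF.toSet_…`), and
  `NF.isClosed_toSet`;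
* **`NF.exists_forall_numCC_le`** — for every `F : NF m k n` there is `N ∈ ℕ` with
  `cc(F(p)) ≤ N` for all `p ∈ ℝᵐ`.  Depth `0` is Khovanskii's theorem in the uniform form proved
  in this tree (`RealExp.exists_forall_numCC_le_of_isQF`); the step `k → k + 1` is Charbonnel's:
  an item is a continuous image of `K = cl(π C(p)) ∩ Δ_τ`, and by the closure lemma
  (`numCC_closure_inter_le`, `CharbonnelClosureLemma.lean`) `cc(K)` is bounded by the components
  of the *sandwich sets* `Δ_τ ∩ B̄(0,R) ∩ {z | ∃ w ∈ C(p), |z - π w| ≤ r}` (Charbonnel's `X(r,t)`,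
  Lemme 2.4 (i)), which are projections of members of a depth-`k` family with two more parameters
  (`NF.sandwich`) — bounded by the induction hypothesis.

Consequences for the Charbonnel closure itself (o-minimal, semi-closed weak structure; `γ < ∞`)
are drawn in the sequel.  Everything is proved; the definitions are the normal-form syntax, its
semantics and operations; no named facts.

## References

* [Charbonnel1991] J.-Y. Charbonnel, *Sur certains sous-ensembles de l'espace euclidien*, Ann.
  Inst. Fourier 41 (1991) 679–717, doi:10.5802/aif.1270: §1 (classes `P_{n,k}`), Lemme 2.2,
  Lemme 2.4 (pp. 687–689), Lemme 2.5 (pp. 689–691), Corollaire 2.6 (held text).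
* [FornasieroServi2010] A. Fornasiero, T. Servi, Fund. Math. 209 (2010), Def. 7.3, Thm. 7.4
  (arXiv:0803.3560, held).
* [Wilkie1999] A. J. Wilkie, Selecta Math. (N.S.) 5 (1999), Thm. 2.1 (not held; cited via the two
  items above).
* [Khovanskii1991] A. G. Khovanskiĭ, *Fewnomials* (1991), Ch. III §3.14.
-/

noncomputable section

open Set Function FirstOrder FirstOrder.Language

namespace Literature.ModelTheory.ExponentialFields

/-! ### Coordinate maps `v ↦ v ∘ σ` on `ℝᵇ → ℝᵃ` -/

section Coord

variable {a b : ℕ}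

/-- `v ↦ v ∘ σ` is continuous. [folklore] -/
theorem continuous_precompCoord (σ : Fin a → Fin b) : Continuous fun v : Fin b → ℝ => v ∘ σ :=
  continuous_pi fun i => continuous_apply (σ i)

/-- For injective `σ`, `v ↦ v ∘ σ` is surjective. [folklore] -/
theorem surjective_precompCoord {σ : Fin a → Fin b} (hσ : Injective σ) :
    Surjective fun v : Fin b → ℝ => v ∘ σ := fun w =>
  ⟨Function.extend σ w 0, by ext i; simp [hσ.extend_apply]⟩

/-- For injective `σ`, `v ↦ v ∘ σ` (a surjective linear map) is an open map. [folklore] -/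
theorem isOpenMap_precompCoord {σ : Fin a → Fin b} (hσ : Injective σ) :
    IsOpenMap fun v : Fin b → ℝ => v ∘ σ := by
  let f : (Fin b → ℝ) →ₗ[ℝ] (Fin a → ℝ) := LinearMap.funLeft ℝ ℝ σ
  have hsurj : Surjective f := LinearMap.funLeft_surjective_of_injective ℝ ℝ σ hσ
  have h := ContinuousLinearMap.isOpenMap (LinearMap.toContinuousLinearMap f) (by simpa using hsurj)
  have hcoe : ((LinearMap.toContinuousLinearMap f : (Fin b → ℝ) →L[ℝ] (Fin a → ℝ)) :
      (Fin b → ℝ) → (Fin a → ℝ)) = fun v => v ∘ σ := by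
    ext v i
    simp [f, LinearMap.funLeft_apply]
  rw [hcoe] at h
  exact h

/-- Pulling back a closure along `v ↦ v ∘ σ` (`σ` injective) is the closure of the pull-back.
[folklore] -/
theorem preimage_closure_precompCoord {σ : Fin a → Fin b} (hσ : Injective σ)
    (A : Set (Fin a → ℝ)) :
    {v : Fin b → ℝ | v ∘ σ ∈ closure A} = closure {v : Fin b → ℝ | v ∘ σ ∈ A} :=
  (isOpenMap_precompCoord hσ).preimage_closure_eq_closure_preimage (continuous_precompCoord σ) A

/-- The block-sum `f ⊕ g : Fin (a + c) → Fin (b + d)` of two maps of finite types. [folklore] -/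
def finSumMap {a b c d : ℕ} (f : Fin a → Fin b) (g : Fin c → Fin d) : Fin (a + c) → Fin (b + d) :=
  fun i => Fin.addCases (fun i₁ => Fin.castAdd d (f i₁)) (fun i₂ => Fin.natAdd b (g i₂)) i

variable {c d : ℕ}

/-- `f ⊕ g` on the left block. [folklore] -/
@[simp] theorem finSumMap_castAdd (f : Fin a → Fin b) (g : Fin c → Fin d) (i : Fin a) :
    finSumMap f g (Fin.castAdd c i) = Fin.castAdd d (f i) := by
  simp [finSumMap]

/-- `f ⊕ g` on the right block. [folklore] -/
@[simp] theorem finSumMap_natAdd (f : Fin a → Fin b) (g : Fin c → Fin d) (j : Fin c) :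
    finSumMap f g (Fin.natAdd a j) = Fin.natAdd b (g j) := by
  simp [finSumMap]

/-- Block sums of injective maps are injective. [folklore] -/
theorem finSumMap_injective {f : Fin a → Fin b} {g : Fin c → Fin d} (hf : Injective f)
    (hg : Injective g) : Injective (finSumMap f g) := by
  intro i j hij
  induction i using Fin.addCases with
  | left i =>
    induction j using Fin.addCases with
    | left j =>
      simp only [finSumMap_castAdd] at hij
      rw [hf (Fin.castAdd_injective _ _ hij)]
    | right j =>
      simp only [finSumMap_castAdd, finSumMap_natAdd, Fin.ext_iff, Fin.val_castAdd,
        Fin.val_natAdd] at hij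
      have := (f i).isLt
      omega
  | right i =>
    induction j using Fin.addCases with
    | left j =>
      simp only [finSumMap_castAdd, finSumMap_natAdd, Fin.ext_iff, Fin.val_castAdd,
        Fin.val_natAdd] at hij
      have := (f j).isLt
      omega
    | right j =>
      simp only [finSumMap_natAdd] at hij
      rw [hg (Fin.natAdd_injective _ _ hij)]

/-- Block sums of surjective maps are surjective. [folklore] -/
theorem finSumMap_surjective {f : Fin a → Fin b} {g : Fin c → Fin d} (hf : Surjective f)
    (hg : Surjective g) : Surjective (finSumMap f g) := by
  intro j
  induction j using Fin.addCases with
  | left j => obtain ⟨i, rfl⟩ := hf j; exact ⟨Fin.castAdd c i, finSumMap_castAdd f g i⟩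
  | right j => obtain ⟨i, rfl⟩ := hg j; exact ⟨Fin.natAdd a i, finSumMap_natAdd f g i⟩

/-- Left block of a pull-back along `f ⊕ g`. [folklore] -/
theorem comp_finSumMap_comp_castAdd {α : Type*} (f : Fin a → Fin b) (g : Fin c → Fin d)
    (v : Fin (b + d) → α) : (v ∘ finSumMap f g) ∘ Fin.castAdd c = (v ∘ Fin.castAdd d) ∘ f := by
  ext i; simp

/-- Right block of a pull-back along `f ⊕ g`. [folklore] -/
theorem comp_finSumMap_comp_natAdd {α : Type*} (f : Fin a → Fin b) (g : Fin c → Fin d)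
    (v : Fin (b + d) → α) : (v ∘ finSumMap f g) ∘ Fin.natAdd a = (v ∘ Fin.natAdd b) ∘ g := by
  ext i; simp

/-- `Fin.append` is jointly continuous. [folklore] -/
theorem continuous_append : Continuous fun q : (Fin a → ℝ) × (Fin b → ℝ) => Fin.append q.1 q.2 := by
  refine continuous_pi fun i => ?_
  induction i using Fin.addCases with
  | left i =>
    simp only [Fin.append_left]
    exact (continuous_apply i).comp continuous_fst
  | right i =>
    simp only [Fin.append_right]
    exact (continuous_apply i).comp continuous_snd

/-- A tuple on `Fin (a + b)` is the `append` of its two blocks. [folklore] -/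
theorem append_castAdd_natAdd {α : Type*} (u : Fin (a + b) → α) :
    Fin.append (u ∘ Fin.castAdd b) (u ∘ Fin.natAdd a) = u := by
  ext i
  induction i using Fin.addCases with
  | left i => simp
  | right i => simp

/-- Left block of `Fin.append`. [folklore] -/
theorem append_comp_castAdd {α : Type*} (u : Fin a → α) (v : Fin b → α) :
    Fin.append u v ∘ Fin.castAdd b = u := funext fun i => Fin.append_left u v i

/-- Right block of `Fin.append`. [folklore] -/
theorem append_comp_natAdd {α : Type*} (u : Fin a → α) (v : Fin b → α) :
    Fin.append u v ∘ Fin.natAdd a = v := funext fun i => Fin.append_right u v i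

/-- **Closure of a "product" of two blocks is the product of the closures.** [folklore] -/
theorem closure_setOf_blocks (A : Set (Fin a → ℝ)) (B : Set (Fin b → ℝ)) :
    closure {u : Fin (a + b) → ℝ | u ∘ Fin.castAdd b ∈ A ∧ u ∘ Fin.natAdd a ∈ B} =
      {u | u ∘ Fin.castAdd b ∈ closure A ∧ u ∘ Fin.natAdd a ∈ closure B} := by
  apply Set.Subset.antisymm
  · -- `⊆`: both pull-backs of closures are closed supersets
    have h1 : closure {u : Fin (a + b) → ℝ | u ∘ Fin.castAdd b ∈ A ∧ u ∘ Fin.natAdd a ∈ B} ⊆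
        {u | u ∘ Fin.castAdd b ∈ closure A} := by
      rw [preimage_closure_precompCoord (Fin.castAdd_injective _ _)]
      exact closure_mono fun u hu => hu.1
    have h2 : closure {u : Fin (a + b) → ℝ | u ∘ Fin.castAdd b ∈ A ∧ u ∘ Fin.natAdd a ∈ B} ⊆
        {u | u ∘ Fin.natAdd a ∈ closure B} := by
      rw [preimage_closure_precompCoord (Fin.natAdd_injective _ _)]
      exact closure_mono fun u hu => hu.2
    exact fun u hu => ⟨h1 hu, h2 hu⟩
  · rintro u ⟨huA, huB⟩
    rw [mem_closure_iff_seq_limit] at huA huB ⊢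
    obtain ⟨xa, hxa, hxalim⟩ := huA
    obtain ⟨xb, hxb, hxblim⟩ := huB
    refine ⟨fun k => Fin.append (xa k) (xb k), fun k => ⟨?_, ?_⟩, ?_⟩
    · show Fin.append (xa k) (xb k) ∘ Fin.castAdd b ∈ A
      rw [append_comp_castAdd]; exact hxa k
    · show Fin.append (xa k) (xb k) ∘ Fin.natAdd a ∈ B
      rw [append_comp_natAdd]; exact hxb k
    have hlim : Filter.Tendsto (fun k => ((xa k, xb k) : (Fin a → ℝ) × (Fin b → ℝ))) Filter.atTop
        (nhds (u ∘ Fin.castAdd b, u ∘ Fin.natAdd a)) :=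
      hxalim.prodMk_nhds hxblim
    have key := (continuous_append.tendsto (u ∘ Fin.castAdd b, u ∘ Fin.natAdd a)).comp hlim
    rw [append_castAdd_natAdd] at key
    exact key

/-- Image of a "product" of blocks under a block-sum coordinate map. [folklore] -/
theorem image_precomp_finSumMap_blocks {D₁ N₁ D₂ N₂ : ℕ} (f : Fin N₁ → Fin D₁) (g : Fin N₂ → Fin D₂)
    (C₁ : Set (Fin D₁ → ℝ)) (C₂ : Set (Fin D₂ → ℝ)) :
    (fun v : Fin (D₁ + D₂) → ℝ => v ∘ finSumMap f g) ''
        {v | v ∘ Fin.castAdd D₂ ∈ C₁ ∧ v ∘ Fin.natAdd D₁ ∈ C₂} =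
      {u : Fin (N₁ + N₂) → ℝ | u ∘ Fin.castAdd N₂ ∈ (fun w : Fin D₁ → ℝ => w ∘ f) '' C₁ ∧
        u ∘ Fin.natAdd N₁ ∈ (fun w : Fin D₂ → ℝ => w ∘ g) '' C₂} := by
  ext u
  simp only [mem_image, mem_setOf_eq]
  constructor
  · rintro ⟨v, ⟨hv1, hv2⟩, rfl⟩
    exact ⟨⟨v ∘ Fin.castAdd D₂, hv1, (comp_finSumMap_comp_castAdd f g v).symm⟩,
      ⟨v ∘ Fin.natAdd D₁, hv2, (comp_finSumMap_comp_natAdd f g v).symm⟩⟩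
  · rintro ⟨⟨w₁, hw₁, hu₁⟩, ⟨w₂, hw₂, hu₂⟩⟩
    refine ⟨Fin.append w₁ w₂, ⟨?_, ?_⟩, ?_⟩
    · rw [append_comp_castAdd]; exact hw₁
    · rw [append_comp_natAdd]; exact hw₂
    ext i
    induction i using Fin.addCases with
    | left i =>
      have := congr_fun hu₁ i
      simp only [Function.comp_apply] at this
      simp [this.symm]
    | right i =>
      have := congr_fun hu₂ i
      simp only [Function.comp_apply] at this
      simp [this.symm]

end Coord

/-! ### Closure items and normal forms -/

/-- A **closure item** over `ℝⁿ` with bodies in `β`: data `(D, N, ι, τ, C)` with `C : β D` (a set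
in `ℝᴰ`, once interpreted), an injective choice `ι` of `N` coordinates of `ℝᴰ` (a coordinate
projection `ℝᴰ → ℝᴺ`), and a surjection `τ : Fin N ↠ Fin n` (a generalized diagonal embedding
`ℝⁿ ↪ ℝᴺ`, `x ↦ x ∘ τ`); it denotes `{x ∈ ℝⁿ | x ∘ τ ∈ cl(πᵢ C)}`
(Charbonnel's building block "`cl(T)`" of the sets of the next closure depth, Lemme 2.2 (ii)).
[cite: Charbonnel1991, Lemme 2.2 (ii)] -/
structure ClItem (β : ℕ → Type) (n : ℕ) where
  /-- ambient dimension of the body -/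
  D : ℕ
  /-- number of kept coordinates -/
  N : ℕ
  /-- the kept coordinates -/
  ι : Fin N → Fin D
  hι : Injective ι
  /-- the generalized diagonal -/
  τ : Fin N → Fin n
  hτ : Surjective τ
  /-- the body, of the previous closure depth -/
  C : β D

/-- The set denoted by a closure item, given the interpretation `S` of bodies.
[cite: Charbonnel1991, Lemme 2.2 (ii)] -/
def ClItem.set {β : ℕ → Type} {n : ℕ} (S : ∀ {e : ℕ}, β e → Set (Fin e → ℝ)) (I : ClItem β n) :
    Set (Fin n → ℝ) :=
  {x | x ∘ I.τ ∈ closure ((fun w : Fin I.D → ℝ => w ∘ I.ι) '' S I.C)}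

/-- **Parametric normal forms of closure depth `k`** for the Charbonnel closure of the
`L_exp`-term zero sets: depth `0` = a term `t(p, x)` (`m` parameters, `n` coordinates); depth
`k + 1` = a finite list (union) of closure items with depth-`k` bodies (Charbonnel's classes
`P_{n,k}`/`P'_{n,k+1}`, in the normal form of Lemme 2.2 (ii)). [cite: Charbonnel1991, §1 and Lemme 2.2 (ii)] -/
def NF (m : ℕ) : ℕ → ℕ → Type
  | 0, n => Language.orderedExpRing.Term (Fin m ⊕ Fin n)
  | k + 1, n => List (ClItem (fun e => NF m k e) n)

/-- A depth-`0` normal form is a term (identity map making the type explicit). [folklore] -/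
def NF.tm {m n : ℕ} (t : NF m 0 n) : Language.orderedExpRing.Term (Fin m ⊕ Fin n) := t
/-- A term as a depth-`0` normal form. [folklore] -/
def NF.ofTm {m n : ℕ} (t : Language.orderedExpRing.Term (Fin m ⊕ Fin n)) : NF m 0 n := t
/-- A depth-`k + 1` normal form is a list of closure items (identity map making the type
explicit). [folklore] -/
def NF.items {m k n : ℕ} (L : NF m (k + 1) n) : List (ClItem (fun e => NF m k e) n) := L
/-- A list of closure items as a depth-`k + 1` normal form. [folklore] -/
def NF.ofItems {m k n : ℕ} (L : List (ClItem (fun e => NF m k e) n)) : NF m (k + 1) n := L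

/-- `tm ∘ ofTm = id`. [folklore] -/
@[simp] theorem NF.tm_ofTm {m n : ℕ} (t : Language.orderedExpRing.Term (Fin m ⊕ Fin n)) :
    NF.tm (NF.ofTm t) = t := rfl
/-- `items ∘ ofItems = id`. [folklore] -/
@[simp] theorem NF.items_ofItems {m k n : ℕ} (L : List (ClItem (fun e => NF m k e) n)) :
    NF.items (NF.ofItems L) = L := rfl

/-- The zero locus `Z(t(p, ·)) = {x ∈ ℝⁿ | t(p, x) = 0}` of a term with parameters `p`.
[cite: Charbonnel1991, §1] -/
def zeroLocus {m n : ℕ} (t : Language.orderedExpRing.Term (Fin m ⊕ Fin n)) (p : Fin m → ℝ) :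
    Set (Fin n → ℝ) :=
  {x | t.realize (Sum.elim p x) = 0}

/-- Semantics of normal forms at parameters `p ∈ ℝᵐ`. [cite: Charbonnel1991, §1 and Lemme 2.2 (ii)] -/
def NF.toSet {m : ℕ} : {k n : ℕ} → NF m k n → (Fin m → ℝ) → Set (Fin n → ℝ)
  | 0, _, t, p => zeroLocus (NF.tm t) p
  | k + 1, _, L, p =>
      {x | ∃ I ∈ NF.items L, x ∈ ClItem.set (fun {e} (C : NF m k e) => NF.toSet C p) I}

section Semantics

variable {m : ℕ}

/-- Semantics at depth `0`: the zero locus. [cite: Charbonnel1991, §1] -/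
@[simp] theorem NF.toSet_zero {n : ℕ} (t : NF m 0 n) (p : Fin m → ℝ) :
    NF.toSet t p = zeroLocus (NF.tm t) p := rfl

/-- Semantics of `ofTm`. [cite: Charbonnel1991, §1] -/
theorem NF.toSet_ofTm {n : ℕ} (t : Language.orderedExpRing.Term (Fin m ⊕ Fin n)) (p : Fin m → ℝ) :
    NF.toSet (NF.ofTm t) p = zeroLocus t p := rfl

/-- Semantics at depth `k + 1`: union of the items. [cite: Charbonnel1991, Lemme 2.2 (ii)] -/
theorem NF.mem_toSet_succ {k n : ℕ} (L : NF m (k + 1) n) (p : Fin m → ℝ) (x : Fin n → ℝ) :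
    x ∈ NF.toSet L p ↔ ∃ I ∈ NF.items L,
      x ∈ ClItem.set (fun {e} (C : NF m k e) => NF.toSet C p) I := Iff.rfl

/-- Semantics of `ofItems`. [cite: Charbonnel1991, Lemme 2.2 (ii)] -/
theorem NF.mem_toSet_ofItems {k n : ℕ} (L : List (ClItem (fun e => NF m k e) n)) (p : Fin m → ℝ)
    (x : Fin n → ℝ) :
    x ∈ NF.toSet (NF.ofItems L) p ↔ ∃ I ∈ L,
      x ∈ ClItem.set (fun {e} (C : NF m k e) => NF.toSet C p) I := Iff.rfl

/-- All sets in normal form are closed. [cite: Charbonnel1991, Lemme 2.2 (v)] -/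
theorem NF.isClosed_toSet : ∀ {k n : ℕ} (F : NF m k n) (p : Fin m → ℝ), IsClosed (NF.toSet F p)
  | 0, _, t, p => by
    simp only [NF.toSet_zero, zeroLocus]
    exact isClosed_eq (RealExpModel.continuous_realize (NF.tm t) p) continuous_const
  | k + 1, n, L, p => by
    have : NF.toSet L p = ⋃ I ∈ NF.items L,
        ClItem.set (fun {e} (C : NF m k e) => NF.toSet C p) I := by
      ext x; simp [NF.mem_toSet_succ]
    rw [this]
    refine (List.finite_toSet (NF.items L)).isClosed_biUnion fun I _ => ?_
    exact isClosed_closure.preimage (continuous_precompCoord I.τ)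

end Semantics

/-! ### Operations on normal forms -/

section Operations

variable {m m' : ℕ}

/-- Reindexing the parameters along `g : Fin m → Fin m'`. [folklore] -/
def NF.mapParams (g : Fin m → Fin m') : {k n : ℕ} → NF m k n → NF m' k n
  | 0, _, t => NF.ofTm ((NF.tm t).relabel (Sum.map g id))
  | _ + 1, _, L => NF.ofItems ((NF.items L).map fun I =>
      ⟨I.D, I.N, I.ι, I.hι, I.τ, I.hτ, NF.mapParams g I.C⟩)

/-- Semantics of `mapParams`: `(mapParams g F)(p) = F(p ∘ g)`. [folklore] -/
theorem NF.toSet_mapParams (g : Fin m → Fin m') :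
    ∀ {k n : ℕ} (F : NF m k n) (p : Fin m' → ℝ), (NF.mapParams g F).toSet p = F.toSet (p ∘ g)
  | 0, _, t, p => by
    ext x
    simp only [NF.mapParams, NF.tm_ofTm, NF.toSet_zero, zeroLocus, mem_setOf_eq,
      Term.realize_relabel, Sum.elim_comp_map, Function.comp_id]
  | k + 1, n, L, p => by
    ext x
    rw [NF.mapParams, NF.mem_toSet_ofItems, NF.mem_toSet_succ]
    simp only [List.mem_map]
    constructor
    · rintro ⟨_, ⟨I, hI, rfl⟩, hx⟩
      refine ⟨I, hI, ?_⟩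
      have h := NF.toSet_mapParams g I.C p
      simp only [ClItem.set, mem_setOf_eq] at hx ⊢
      rwa [h] at hx
    · rintro ⟨I, hI, hx⟩
      refine ⟨_, ⟨I, hI, rfl⟩, ?_⟩
      have h := NF.toSet_mapParams g I.C p
      simp only [ClItem.set, mem_setOf_eq] at hx ⊢
      rwa [h]

/-- Pulling back along a coordinate permutation `σ : Fin n ≃ Fin n'`: `{y | y ∘ σ ∈ F}`. [folklore] -/
def NF.perm : {k n n' : ℕ} → (Fin n ≃ Fin n') → NF m k n → NF m k n'
  | 0, _, _, σ, t => NF.ofTm ((NF.tm t).relabel (Sum.map id σ))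
  | _ + 1, _, _, σ, L => NF.ofItems ((NF.items L).map fun I =>
      ⟨I.D, I.N, I.ι, I.hι, σ ∘ I.τ, σ.surjective.comp I.hτ, I.C⟩)

/-- Semantics of `perm`: `(perm σ F)(p) = {y | y ∘ σ ∈ F(p)}`. [folklore] -/
theorem NF.toSet_perm : ∀ {k n n' : ℕ} (σ : Fin n ≃ Fin n') (F : NF m k n) (p : Fin m → ℝ),
    (NF.perm σ F).toSet p = {y | y ∘ σ ∈ F.toSet p}
  | 0, _, _, σ, t, p => by
    ext y
    simp only [NF.perm, NF.tm_ofTm, NF.toSet_zero, zeroLocus, mem_setOf_eq,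
      Term.realize_relabel, Sum.elim_comp_map, Function.comp_id]
  | k + 1, n, n', σ, L, p => by
    ext y
    rw [NF.perm, NF.mem_toSet_ofItems, mem_setOf_eq, NF.mem_toSet_succ]
    simp only [List.mem_map]
    constructor
    · rintro ⟨_, ⟨I, hI, rfl⟩, hx⟩
      refine ⟨I, hI, ?_⟩
      simp only [ClItem.set, mem_setOf_eq] at hx ⊢
      exact hx
    · rintro ⟨I, hI, hx⟩
      refine ⟨_, ⟨I, hI, rfl⟩, ?_⟩
      simp only [ClItem.set, mem_setOf_eq] at hx ⊢
      exact hx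

/-- Right cylinder `F × ℝᵉ ⊆ ℝⁿ⁺ᵉ`: `{y | y ∘ castAdd e ∈ F}`. [folklore] -/
def NF.cylRight (e : ℕ) : {k n : ℕ} → NF m k n → NF m k (n + e)
  | 0, _, t => NF.ofTm ((NF.tm t).relabel (Sum.map id (Fin.castAdd e)))
  | _ + 1, _, L => NF.ofItems ((NF.items L).map fun I =>
      ⟨I.D + e, I.N + e, finSumMap I.ι id, finSumMap_injective I.hι injective_id,
        finSumMap I.τ id, finSumMap_surjective I.hτ surjective_id, NF.cylRight e I.C⟩)

/-- Left cylinder `ℝᵉ × F ⊆ ℝᵉ⁺ⁿ`: `{y | y ∘ natAdd e ∈ F}`. [folklore] -/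
def NF.cylLeft (e : ℕ) : {k n : ℕ} → NF m k n → NF m k (e + n)
  | 0, _, t => NF.ofTm ((NF.tm t).relabel (Sum.map id (Fin.natAdd e)))
  | _ + 1, _, L => NF.ofItems ((NF.items L).map fun I =>
      ⟨e + I.D, e + I.N, finSumMap id I.ι, finSumMap_injective injective_id I.hι,
        finSumMap id I.τ, finSumMap_surjective surjective_id I.hτ, NF.cylLeft e I.C⟩)

/-- The image of a right cylinder under a block-sum projection. [folklore] -/
theorem image_precomp_finSumMap_id_right {D N e : ℕ} (ι : Fin N → Fin D) (C : Set (Fin D → ℝ)) :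
    (fun v : Fin (D + e) → ℝ => v ∘ finSumMap ι id) '' {v | v ∘ Fin.castAdd e ∈ C} =
      {u : Fin (N + e) → ℝ | u ∘ Fin.castAdd e ∈ (fun w : Fin D → ℝ => w ∘ ι) '' C} := by
  have h := image_precomp_finSumMap_blocks ι (id : Fin e → Fin e) C Set.univ
  simp only [mem_univ, and_true] at h
  rw [h]
  ext u
  simp only [mem_setOf_eq, and_iff_left_iff_imp]
  intro _
  exact ⟨u ∘ Fin.natAdd N, trivial, rfl⟩

/-- The image of a left cylinder under a block-sum projection. [folklore] -/
theorem image_precomp_finSumMap_id_left {D N e : ℕ} (ι : Fin N → Fin D) (C : Set (Fin D → ℝ)) :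
    (fun v : Fin (e + D) → ℝ => v ∘ finSumMap id ι) '' {v | v ∘ Fin.natAdd e ∈ C} =
      {u : Fin (e + N) → ℝ | u ∘ Fin.natAdd e ∈ (fun w : Fin D → ℝ => w ∘ ι) '' C} := by
  have h := image_precomp_finSumMap_blocks (id : Fin e → Fin e) ι Set.univ C
  simp only [mem_univ, true_and] at h
  rw [h]
  ext u
  simp only [mem_setOf_eq, and_iff_right_iff_imp]
  intro _
  exact ⟨u ∘ Fin.castAdd N, trivial, rfl⟩

/-- Semantics of `cylRight`: `F(p) × ℝᵉ`. [folklore] -/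
theorem NF.toSet_cylRight (e : ℕ) : ∀ {k n : ℕ} (F : NF m k n) (p : Fin m → ℝ),
    (NF.cylRight e F).toSet p = {y | y ∘ Fin.castAdd e ∈ F.toSet p}
  | 0, _, t, p => by
    ext y
    simp only [NF.cylRight, NF.tm_ofTm, NF.toSet_zero, zeroLocus, mem_setOf_eq,
      Term.realize_relabel, Sum.elim_comp_map, Function.comp_id]
  | k + 1, n, L, p => by
    ext y
    rw [NF.cylRight, NF.mem_toSet_ofItems, mem_setOf_eq, NF.mem_toSet_succ]
    simp only [List.mem_map]
    have key : ∀ I : ClItem (fun e => NF m k e) n,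
        y ∈ ClItem.set (fun {e'} (C : NF m k e') => NF.toSet C p)
          (⟨I.D + e, I.N + e, finSumMap I.ι id, finSumMap_injective I.hι injective_id,
            finSumMap I.τ id, finSumMap_surjective I.hτ surjective_id, NF.cylRight e I.C⟩ :
            ClItem (fun e => NF m k e) (n + e)) ↔
        y ∘ Fin.castAdd e ∈ ClItem.set (fun {e'} (C : NF m k e') => NF.toSet C p) I := by
      intro I
      simp only [ClItem.set, mem_setOf_eq]
      rw [NF.toSet_cylRight e I.C p, image_precomp_finSumMap_id_right,
        ← preimage_closure_precompCoord (Fin.castAdd_injective _ _)]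
      simp only [mem_setOf_eq]
      rw [comp_finSumMap_comp_castAdd]
    constructor
    · rintro ⟨_, ⟨I, hI, rfl⟩, hx⟩
      exact ⟨I, hI, (key I).1 hx⟩
    · rintro ⟨I, hI, hx⟩
      exact ⟨_, ⟨I, hI, rfl⟩, (key I).2 hx⟩

/-- Semantics of `cylLeft`: `ℝᵉ × F(p)`. [folklore] -/
theorem NF.toSet_cylLeft (e : ℕ) : ∀ {k n : ℕ} (F : NF m k n) (p : Fin m → ℝ),
    (NF.cylLeft e F).toSet p = {y | y ∘ Fin.natAdd e ∈ F.toSet p}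
  | 0, _, t, p => by
    ext y
    simp only [NF.cylLeft, NF.tm_ofTm, NF.toSet_zero, zeroLocus, mem_setOf_eq,
      Term.realize_relabel, Sum.elim_comp_map, Function.comp_id]
  | k + 1, n, L, p => by
    ext y
    rw [NF.cylLeft, NF.mem_toSet_ofItems, mem_setOf_eq, NF.mem_toSet_succ]
    simp only [List.mem_map]
    have key : ∀ I : ClItem (fun e => NF m k e) n,
        y ∈ ClItem.set (fun {e'} (C : NF m k e') => NF.toSet C p)
          (⟨e + I.D, e + I.N, finSumMap id I.ι, finSumMap_injective injective_id I.hι,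
            finSumMap id I.τ, finSumMap_surjective surjective_id I.hτ, NF.cylLeft e I.C⟩ :
            ClItem (fun e => NF m k e) (e + n)) ↔
        y ∘ Fin.natAdd e ∈ ClItem.set (fun {e'} (C : NF m k e') => NF.toSet C p) I := by
      intro I
      simp only [ClItem.set, mem_setOf_eq]
      rw [NF.toSet_cylLeft e I.C p, image_precomp_finSumMap_id_left,
        ← preimage_closure_precompCoord (Fin.natAdd_injective _ _)]
      simp only [mem_setOf_eq]
      rw [comp_finSumMap_comp_natAdd]
    constructor
    · rintro ⟨_, ⟨I, hI, rfl⟩, hx⟩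
      exact ⟨I, hI, (key I).1 hx⟩
    · rintro ⟨I, hI, hx⟩
      exact ⟨_, ⟨I, hI, rfl⟩, (key I).2 hx⟩

/-- Depth `k` normal forms as depth `k + 1` normal forms (a closed set is the closure of its
trivial projection). [cite: Charbonnel1991, Lemme 2.2 (iii)] -/
def NF.lift {k n : ℕ} (F : NF m k n) : NF m (k + 1) n :=
  NF.ofItems [⟨n, n, id, injective_id, id, surjective_id, F⟩]

/-- Semantics of `lift`: the same set (it is closed). [cite: Charbonnel1991, Lemme 2.2 (iii)] -/
theorem NF.toSet_lift {k n : ℕ} (F : NF m k n) (p : Fin m → ℝ) :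
    (NF.lift F).toSet p = F.toSet p := by
  ext x
  rw [NF.lift, NF.mem_toSet_ofItems]
  simp only [List.mem_singleton, exists_eq_left, ClItem.set, mem_setOf_eq]
  have himg : (fun w : Fin n → ℝ => w ∘ id) '' F.toSet p = F.toSet p := by
    have : (fun w : Fin n → ℝ => w ∘ id) = id := rfl
    rw [this, Set.image_id]
  have hid : x ∘ (id : Fin n → Fin n) = x := rfl
  rw [himg, (NF.isClosed_toSet F p).closure_eq, hid]

/-- A term as a normal form of any depth. [cite: Charbonnel1991, §1] -/
def NF.ofTerm : (k : ℕ) → {n : ℕ} → Language.orderedExpRing.Term (Fin m ⊕ Fin n) → NF m k n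
  | 0, _, t => NF.ofTm t
  | k + 1, _, t => NF.lift (NF.ofTerm k t)

/-- Semantics of `ofTerm`: the zero locus, at any depth. [cite: Charbonnel1991, §1] -/
theorem NF.toSet_ofTerm : ∀ (k : ℕ) {n : ℕ} (t : Language.orderedExpRing.Term (Fin m ⊕ Fin n))
    (p : Fin m → ℝ), (NF.ofTerm k t).toSet p = zeroLocus t p
  | 0, _, t, p => rfl
  | k + 1, _, t, p => by rw [NF.ofTerm, NF.toSet_lift, NF.toSet_ofTerm k t p]

/-- Union of normal forms (product of terms at depth `0`, concatenation above).
[cite: Charbonnel1991, Lemme 2.2 (i)] -/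
def NF.union : {k n : ℕ} → NF m k n → NF m k n → NF m k n
  | 0, _, t₁, t₂ => NF.ofTm (NF.tm t₁ * NF.tm t₂)
  | _ + 1, _, L₁, L₂ => NF.ofItems (NF.items L₁ ++ NF.items L₂)

/-- Semantics of `union`. [cite: Charbonnel1991, Lemme 2.2 (i)] -/
theorem NF.toSet_union : ∀ {k n : ℕ} (F G : NF m k n) (p : Fin m → ℝ),
    (NF.union F G).toSet p = F.toSet p ∪ G.toSet p
  | 0, _, t₁, t₂, p => by
    ext x
    simp [NF.union, NF.tm_ofTm, zeroLocus, Language.orderedExpRing.realize_mul, mul_eq_zero]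
  | k + 1, _, L₁, L₂, p => by
    ext x
    rw [NF.union, NF.mem_toSet_ofItems, mem_union, NF.mem_toSet_succ, NF.mem_toSet_succ]
    simp only [List.mem_append]
    constructor
    · rintro ⟨I, hI | hI, hx⟩
      · exact Or.inl ⟨I, hI, hx⟩
      · exact Or.inr ⟨I, hI, hx⟩
    · rintro (⟨I, hI, hx⟩ | ⟨I, hI, hx⟩)
      · exact ⟨I, Or.inl hI, hx⟩
      · exact ⟨I, Or.inr hI, hx⟩

/-- The product item of two closure items (product of the bodies, block sums of the coordinate
data): it denotes the intersection of the two items (the product trick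
`cl(A) ∩ cl(B) ≅ cl(A × B) ∩ Δ`). [cite: Charbonnel1991, Lemme 2.4 (iv)] -/
def ClItem.prod {k n : ℕ} (I J : ClItem (fun e => NF m k e) n)
    (inter : ∀ {e : ℕ}, NF m k e → NF m k e → NF m k e) : ClItem (fun e => NF m k e) n :=
  ⟨I.D + J.D, I.N + J.N, finSumMap I.ι J.ι, finSumMap_injective I.hι J.hι,
    fun i => Fin.addCases I.τ J.τ i,
    fun j => by obtain ⟨i, hi⟩ := I.hτ j; exact ⟨Fin.castAdd J.N i, by simp [hi]⟩,
    inter (NF.cylRight J.D I.C) (NF.cylLeft I.D J.C)⟩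

/-- Intersection of normal forms (sum of squares at depth `0`, pairwise products of items above).
[cite: Charbonnel1991, Lemme 2.2 (i)] -/
def NF.inter : {k n : ℕ} → NF m k n → NF m k n → NF m k n
  | 0, _, t₁, t₂ => NF.ofTm (NF.tm t₁ * NF.tm t₁ + NF.tm t₂ * NF.tm t₂)
  | _ + 1, _, L₁, L₂ => NF.ofItems ((NF.items L₁).flatMap fun I =>
      (NF.items L₂).map fun J => ClItem.prod I J (fun F G => NF.inter F G))

/-- Semantics of the product item. [cite: Charbonnel1991, Lemme 2.4 (iv)] -/
theorem ClItem.set_prod {k n : ℕ} (I J : ClItem (fun e => NF m k e) n)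
    (inter : ∀ {e : ℕ}, NF m k e → NF m k e → NF m k e) (p : Fin m → ℝ)
    (hinter : ∀ {e : ℕ} (F G : NF m k e), (inter F G).toSet p = F.toSet p ∩ G.toSet p) :
    ClItem.set (fun {e} (C : NF m k e) => NF.toSet C p) (ClItem.prod I J inter) =
      ClItem.set (fun {e} (C : NF m k e) => NF.toSet C p) I ∩
        ClItem.set (fun {e} (C : NF m k e) => NF.toSet C p) J := by
  ext x
  simp only [ClItem.set, ClItem.prod, mem_setOf_eq, mem_inter_iff]
  rw [hinter, NF.toSet_cylRight, NF.toSet_cylLeft]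
  have hblocks : {v : Fin (I.D + J.D) → ℝ | v ∘ Fin.castAdd J.D ∈ NF.toSet I.C p} ∩
      {v | v ∘ Fin.natAdd I.D ∈ NF.toSet J.C p} =
      {v | v ∘ Fin.castAdd J.D ∈ NF.toSet I.C p ∧ v ∘ Fin.natAdd I.D ∈ NF.toSet J.C p} := rfl
  rw [hblocks, image_precomp_finSumMap_blocks]
  refine (Set.ext_iff.1 (closure_setOf_blocks ((fun w : Fin I.D → ℝ => w ∘ I.ι) '' NF.toSet I.C p)
      ((fun w : Fin J.D → ℝ => w ∘ J.ι) '' NF.toSet J.C p)) _).trans ?_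
  simp only [mem_setOf_eq]
  have h1 : (x ∘ fun i => Fin.addCases I.τ J.τ i) ∘ Fin.castAdd J.N = x ∘ I.τ := by
    ext i; simp
  have h2 : (x ∘ fun i => Fin.addCases I.τ J.τ i) ∘ Fin.natAdd I.N = x ∘ J.τ := by
    ext i; simp
  rw [h1, h2]

/-- Semantics of `inter`. [cite: Charbonnel1991, Lemme 2.2 (i)] -/
theorem NF.toSet_inter : ∀ {k n : ℕ} (F G : NF m k n) (p : Fin m → ℝ),
    (NF.inter F G).toSet p = F.toSet p ∩ G.toSet p
  | 0, _, t₁, t₂, p => by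
    ext x
    simp only [NF.inter, NF.tm_ofTm, NF.toSet_zero, zeroLocus, mem_setOf_eq, mem_inter_iff,
      Language.orderedExpRing.realize_add, Language.orderedExpRing.realize_mul]
    constructor
    · intro h
      have h1 : (NF.tm t₁).realize (Sum.elim p x) * (NF.tm t₁).realize (Sum.elim p x) = 0 := by
        nlinarith [mul_self_nonneg ((NF.tm t₁).realize (Sum.elim p x)),
          mul_self_nonneg ((NF.tm t₂).realize (Sum.elim p x))]
      have h2 : (NF.tm t₂).realize (Sum.elim p x) * (NF.tm t₂).realize (Sum.elim p x) = 0 := by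
        nlinarith [mul_self_nonneg ((NF.tm t₁).realize (Sum.elim p x)),
          mul_self_nonneg ((NF.tm t₂).realize (Sum.elim p x))]
      exact ⟨mul_self_eq_zero.1 h1, mul_self_eq_zero.1 h2⟩
    · rintro ⟨h1, h2⟩
      rw [h1, h2]; ring
  | k + 1, n, L₁, L₂, p => by
    ext x
    rw [NF.inter, NF.mem_toSet_ofItems, mem_inter_iff, NF.mem_toSet_succ, NF.mem_toSet_succ]
    simp only [List.mem_flatMap, List.mem_map]
    constructor
    · rintro ⟨_, ⟨I, hI, J, hJ, rfl⟩, hx⟩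
      rw [ClItem.set_prod I J _ p (fun F G => NF.toSet_inter F G p)] at hx
      exact ⟨⟨I, hI, hx.1⟩, ⟨J, hJ, hx.2⟩⟩
    · rintro ⟨⟨I, hI, hxI⟩, ⟨J, hJ, hxJ⟩⟩
      refine ⟨_, ⟨I, hI, J, hJ, rfl⟩, ?_⟩
      rw [ClItem.set_prod I J _ p (fun F G => NF.toSet_inter F G p)]
      exact ⟨hxI, hxJ⟩

/-- The closure of a coordinate projection of a depth-`k` set, pulled back along a generalized
diagonal, as a depth-`k + 1` normal form (one item). [cite: Charbonnel1991, §1] -/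
def NF.closureItem {k n D N : ℕ} (ι : Fin N → Fin D) (hι : Injective ι) (τ : Fin N → Fin n)
    (hτ : Surjective τ) (C : NF m k D) : NF m (k + 1) n :=
  NF.ofItems [⟨D, N, ι, hι, τ, hτ, C⟩]

/-- Semantics of `closureItem`. [cite: Charbonnel1991, §1] -/
theorem NF.toSet_closureItem {k n D N : ℕ} (ι : Fin N → Fin D) (hι : Injective ι)
    (τ : Fin N → Fin n) (hτ : Surjective τ) (C : NF m k D) (p : Fin m → ℝ) :
    (NF.closureItem ι hι τ hτ C).toSet p =
      {x | x ∘ τ ∈ closure ((fun w : Fin D → ℝ => w ∘ ι) '' C.toSet p)} := by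
  ext x
  rw [NF.closureItem, NF.mem_toSet_ofItems]
  simp [ClItem.set]

end Operations

/-! ## Part II: uniform tameness -/

section Tameness

open Metric

variable {m : ℕ}

/-! ### Depth `0`: Khovanskii -/

/-- Uniform bound at closure depth `0` (term zero sets): Khovanskii's theorem.
[cite: Khovanskii1991, Ch. III §3.14] -/
theorem NF.exists_forall_numCC_le_zero {n : ℕ} (t : NF m 0 n) :
    ∃ N : ℕ, ∀ p : Fin m → ℝ, numCC (NF.toSet t p) ≤ N := by
  have hφ : (Term.equal (NF.tm t) 0).IsQF := (BoundedFormula.IsAtomic.equal _ _).isQF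
  obtain ⟨N, hN⟩ := RealExp.exists_forall_numCC_le_of_isQF hφ
  refine ⟨N, fun p => ?_⟩
  have hset : {x : Fin n → ℝ | (Term.equal (NF.tm t) 0).Realize (Sum.elim p x)} = NF.toSet t p := by
    ext x
    simp [NF.toSet_zero, zeroLocus, Formula.realize_equal, Language.orderedExpRing.realize_zero]
  rw [← hset]
  exact hN p

/-! ### The sandwich family of a closure item -/

section Sandwich

variable {k n D N : ℕ}

/-- Coordinate of the body block `w ∈ ℝᴰ`. [folklore] -/
def sandV (N : ℕ) (j : Fin D) : Fin (D + (N + (N + N))) := Fin.castAdd _ j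
/-- Coordinate of the point block `z ∈ ℝᴺ`. [folklore] -/
def sandZ (D : ℕ) (i : Fin N) : Fin (D + (N + (N + N))) := Fin.natAdd D (Fin.castAdd (N + N) i)
/-- Coordinate of the first slack block `s ∈ ℝᴺ` (ball condition). [folklore] -/
def sandS (D : ℕ) (i : Fin N) : Fin (D + (N + (N + N))) := Fin.natAdd D (Fin.natAdd N (Fin.castAdd N i))
/-- Coordinate of the second slack block `s' ∈ ℝᴺ` (nearness condition). [folklore] -/
def sandS' (D : ℕ) (i : Fin N) : Fin (D + (N + (N + N))) := Fin.natAdd D (Fin.natAdd N (Fin.natAdd N i))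
/-- The parameter `R` (ball radius). [folklore] -/
def sandR (m : ℕ) : Fin (m + 2) := Fin.natAdd m 0
/-- The parameter `r` (nearness radius). [folklore] -/
def sandRr (m : ℕ) : Fin (m + 2) := Fin.natAdd m 1

/-- Abbreviation: the variables of the sandwich term. [folklore] -/
abbrev SandVars (m D N : ℕ) : Type := Fin (m + 2) ⊕ Fin (D + (N + (N + N)))

/-- Square of a term. [folklore] -/
def sqT {α : Type} (t : Language.orderedExpRing.Term α) : Language.orderedExpRing.Term α := t * t

/-- Realization of `sqT`. [folklore] -/
@[simp] theorem realize_sqT {α : Type} (t : Language.orderedExpRing.Term α) (v : α → ℝ) :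
    (sqT t).realize v = t.realize v * t.realize v := rfl

/-- The diagonal part `Σ_{τ i = τ i'} (zᵢ - z_{i'})²`. [folklore] -/
def diagT (m D : ℕ) (τ : Fin N → Fin n) : Language.orderedExpRing.Term (SandVars m D N) :=
  RealExp.finSum fun i => RealExp.finSum fun i' =>
    if τ i = τ i' then sqT (Term.var (Sum.inr (sandZ D i)) + -Term.var (Sum.inr (sandZ D i')))
    else 0

/-- The ball part `Σᵢ (R² - zᵢ² - sᵢ²)²`. [folklore] -/
def ballT (m D N : ℕ) : Language.orderedExpRing.Term (SandVars m D N) :=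
  RealExp.finSum fun i : Fin N =>
    sqT (sqT (Term.var (Sum.inl (sandR m))) + -sqT (Term.var (Sum.inr (sandZ D i))) +
      -sqT (Term.var (Sum.inr (sandS D i))))

/-- The nearness part `Σᵢ (r² - (zᵢ - w_{ι i})² - s'ᵢ²)²`. [folklore] -/
def nearT (m : ℕ) (ι : Fin N → Fin D) : Language.orderedExpRing.Term (SandVars m D N) :=
  RealExp.finSum fun i : Fin N =>
    sqT (sqT (Term.var (Sum.inl (sandRr m))) +
      -sqT (Term.var (Sum.inr (sandZ D i)) + -Term.var (Sum.inr (sandV N (ι i)))) +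
      -sqT (Term.var (Sum.inr (sandS' D i))))

/-- The sandwich term: vanishes iff `z ∈ Δ_τ`, `R² - zᵢ² = sᵢ²` and `r² - (zᵢ - w_{ι i})² = s'ᵢ²`
for all `i`. [cite: Charbonnel1991, Lemme 2.4 (i)] -/
def sandT (m : ℕ) (ι : Fin N → Fin D) (τ : Fin N → Fin n) :
    Language.orderedExpRing.Term (SandVars m D N) :=
  diagT m D τ + ballT m D N + nearT m ι

/-- The sandwich term vanishes iff the diagonal, ball and nearness conditions hold.
[cite: Charbonnel1991, Lemme 2.4 (i)] -/
theorem realize_sandT_eq_zero_iff (ι : Fin N → Fin D) (τ : Fin N → Fin n) (v : SandVars m D N → ℝ) :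
    (sandT m ι τ).realize v = 0 ↔
      (∀ i i', τ i = τ i' → v (Sum.inr (sandZ D i)) = v (Sum.inr (sandZ D i'))) ∧
      (∀ i, v (Sum.inl (sandR m)) * v (Sum.inl (sandR m)) -
          v (Sum.inr (sandZ D i)) * v (Sum.inr (sandZ D i)) -
          v (Sum.inr (sandS D i)) * v (Sum.inr (sandS D i)) = 0) ∧
      (∀ i, v (Sum.inl (sandRr m)) * v (Sum.inl (sandRr m)) -
          (v (Sum.inr (sandZ D i)) - v (Sum.inr (sandV N (ι i)))) *
            (v (Sum.inr (sandZ D i)) - v (Sum.inr (sandV N (ι i)))) -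
          v (Sum.inr (sandS' D i)) * v (Sum.inr (sandS' D i)) = 0) := by
  classical
  -- the three parts are sums of squares
  have hdiag : (diagT m D τ).realize v =
      ∑ i, ∑ i', if τ i = τ i' then
        (v (Sum.inr (sandZ D i)) - v (Sum.inr (sandZ D i'))) *
          (v (Sum.inr (sandZ D i)) - v (Sum.inr (sandZ D i'))) else 0 := by
    simp only [diagT, RealExp.realize_finSum]
    refine Finset.sum_congr rfl fun i _ => Finset.sum_congr rfl fun i' _ => ?_
    split_ifs
    · simp [sub_eq_add_neg]
    · rfl
  have hball : (ballT m D N).realize v =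
      ∑ i, (v (Sum.inl (sandR m)) * v (Sum.inl (sandR m)) -
          v (Sum.inr (sandZ D i)) * v (Sum.inr (sandZ D i)) -
          v (Sum.inr (sandS D i)) * v (Sum.inr (sandS D i))) *
        (v (Sum.inl (sandR m)) * v (Sum.inl (sandR m)) -
          v (Sum.inr (sandZ D i)) * v (Sum.inr (sandZ D i)) -
          v (Sum.inr (sandS D i)) * v (Sum.inr (sandS D i))) := by
    simp only [ballT, RealExp.realize_finSum, realize_sqT, Language.orderedExpRing.realize_add,
      Language.orderedExpRing.realize_neg, Term.realize_var]
    refine Finset.sum_congr rfl fun i _ => by ring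
  have hnear : (nearT m ι).realize v =
      ∑ i, (v (Sum.inl (sandRr m)) * v (Sum.inl (sandRr m)) -
          (v (Sum.inr (sandZ D i)) - v (Sum.inr (sandV N (ι i)))) *
            (v (Sum.inr (sandZ D i)) - v (Sum.inr (sandV N (ι i)))) -
          v (Sum.inr (sandS' D i)) * v (Sum.inr (sandS' D i))) *
        (v (Sum.inl (sandRr m)) * v (Sum.inl (sandRr m)) -
          (v (Sum.inr (sandZ D i)) - v (Sum.inr (sandV N (ι i)))) *
            (v (Sum.inr (sandZ D i)) - v (Sum.inr (sandV N (ι i)))) -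
          v (Sum.inr (sandS' D i)) * v (Sum.inr (sandS' D i))) := by
    simp only [nearT, RealExp.realize_finSum, realize_sqT, Language.orderedExpRing.realize_add,
      Language.orderedExpRing.realize_neg, Term.realize_var]
    refine Finset.sum_congr rfl fun i _ => by ring
  have h1 : 0 ≤ (diagT m D τ).realize v := by
    rw [hdiag]
    refine Finset.sum_nonneg fun i _ => Finset.sum_nonneg fun i' _ => ?_
    split_ifs
    · exact mul_self_nonneg _
    · exact le_rfl
  have h2 : 0 ≤ (ballT m D N).realize v := by
    rw [hball]; exact Finset.sum_nonneg fun i _ => mul_self_nonneg _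
  have h3 : 0 ≤ (nearT m ι).realize v := by
    rw [hnear]; exact Finset.sum_nonneg fun i _ => mul_self_nonneg _
  have hsum : (sandT m ι τ).realize v =
      (diagT m D τ).realize v + (ballT m D N).realize v + (nearT m ι).realize v := by
    simp [sandT, Language.orderedExpRing.realize_add]
  rw [hsum]
  constructor
  · intro h
    have hd0 : (diagT m D τ).realize v = 0 := by linarith
    have hb0 : (ballT m D N).realize v = 0 := by linarith
    have hn0 : (nearT m ι).realize v = 0 := by linarith
    refine ⟨?_, ?_, ?_⟩
    · intro i i' hii'
      rw [hdiag] at hd0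
      have hi := (Finset.sum_eq_zero_iff_of_nonneg (fun i _ => Finset.sum_nonneg fun i' _ => by
        split_ifs
        · exact mul_self_nonneg _
        · exact le_rfl)).1 hd0 i (Finset.mem_univ i)
      have hi' := (Finset.sum_eq_zero_iff_of_nonneg (fun i' _ => by
        split_ifs
        · exact mul_self_nonneg _
        · exact le_rfl)).1 hi i' (Finset.mem_univ i')
      rw [if_pos hii'] at hi'
      have := mul_self_eq_zero.1 hi'
      linarith
    · intro i
      rw [hball] at hb0
      have hi := (Finset.sum_eq_zero_iff_of_nonneg (fun i _ => mul_self_nonneg _)).1 hb0 i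
        (Finset.mem_univ i)
      exact mul_self_eq_zero.1 hi
    · intro i
      rw [hnear] at hn0
      have hi := (Finset.sum_eq_zero_iff_of_nonneg (fun i _ => mul_self_nonneg _)).1 hn0 i
        (Finset.mem_univ i)
      exact mul_self_eq_zero.1 hi
  · rintro ⟨hd, hb, hn⟩
    have hd0 : (diagT m D τ).realize v = 0 := by
      rw [hdiag]
      refine Finset.sum_eq_zero fun i _ => Finset.sum_eq_zero fun i' _ => ?_
      split_ifs with hii'
      · rw [hd i i' hii', sub_self, mul_zero]
      · rfl
    have hb0 : (ballT m D N).realize v = 0 := by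
      rw [hball]
      exact Finset.sum_eq_zero fun i _ => by rw [hb i, mul_zero]
    have hn0 : (nearT m ι).realize v = 0 := by
      rw [hnear]
      exact Finset.sum_eq_zero fun i _ => by rw [hn i, mul_zero]
    rw [hd0, hb0, hn0]; ring

/-- **The sandwich family** of a closure item `(D, N, ι, τ, C)` with `C : NF m k D`: the depth-`k`
normal form in the coordinates `(w, z, s, s') ∈ ℝᴰ × ℝᴺ × ℝᴺ × ℝᴺ` and parameters `(p, R, r)`
cut out by `w ∈ C(p)`, `z ∈ Δ_τ`, `R² - zᵢ² = sᵢ²`, `r² - (zᵢ - w_{ι i})² = s'ᵢ²`; its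
`z`-projection is Charbonnel's set `X(r, t)` (Lemme 2.4 (i)) for `B = π_ι C(p)` on the
generalized diagonal. [cite: Charbonnel1991, Lemme 2.4 (i)] -/
def NF.sandwich (ι : Fin N → Fin D) (τ : Fin N → Fin n) (C : NF m k D) :
    NF (m + 2) k (D + (N + (N + N))) :=
  NF.inter (NF.cylRight (N + (N + N)) (NF.mapParams (Fin.castAdd 2) C))
    (NF.ofTerm k (sandT m ι τ))

/-- The parameters `(p, R, r)`. [folklore] -/
def sandParams (p : Fin m → ℝ) (R r : ℝ) : Fin (m + 2) → ℝ := Fin.append p ![R, r]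

/-- The old parameters inside `(p, R, r)`. [folklore] -/
@[simp] theorem sandParams_castAdd (p : Fin m → ℝ) (R r : ℝ) (j : Fin m) :
    sandParams p R r (Fin.castAdd 2 j) = p j := by
  show Fin.append p ![R, r] (Fin.castAdd 2 j) = p j
  rw [Fin.append_left]

/-- The parameter `R` inside `(p, R, r)`. [folklore] -/
@[simp] theorem sandParams_sandR (p : Fin m → ℝ) (R r : ℝ) : sandParams p R r (sandR m) = R := by
  show Fin.append p ![R, r] (Fin.natAdd m 0) = R
  rw [Fin.append_right]; rfl

/-- The parameter `r` inside `(p, R, r)`. [folklore] -/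
@[simp] theorem sandParams_sandRr (p : Fin m → ℝ) (R r : ℝ) : sandParams p R r (sandRr m) = r := by
  show Fin.append p ![R, r] (Fin.natAdd m 1) = r
  rw [Fin.append_right]; rfl

/-- Membership in the sandwich family. [cite: Charbonnel1991, Lemme 2.4 (i)] -/
theorem NF.mem_toSet_sandwich_iff (ι : Fin N → Fin D) (τ : Fin N → Fin n) (C : NF m k D)
    (p : Fin m → ℝ) (R r : ℝ) (u : Fin (D + (N + (N + N))) → ℝ) :
    u ∈ (NF.sandwich ι τ C).toSet (sandParams p R r) ↔
      u ∘ Fin.castAdd (N + (N + N)) ∈ C.toSet p ∧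
      (∀ i i', τ i = τ i' → u (sandZ D i) = u (sandZ D i')) ∧
      (∀ i, R * R - u (sandZ D i) * u (sandZ D i) - u (sandS D i) * u (sandS D i) = 0) ∧
      (∀ i, r * r - (u (sandZ D i) - u (sandV N (ι i))) * (u (sandZ D i) - u (sandV N (ι i))) -
          u (sandS' D i) * u (sandS' D i) = 0) := by
  simp only [NF.sandwich, NF.toSet_inter, NF.toSet_cylRight, NF.toSet_mapParams, NF.toSet_ofTerm,
    zeroLocus, mem_inter_iff, mem_setOf_eq]
  have hp : sandParams p R r ∘ Fin.castAdd 2 = p := by ext j; simp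
  rw [hp, realize_sandT_eq_zero_iff]
  simp

end Sandwich

/-! ### The closure step -/

section Step

variable {k n : ℕ}

/-- The generalized diagonal `Δ_τ = {z | τ i = τ i' → zᵢ = z_{i'}}` is closed. [folklore] -/
theorem isClosed_diagonalOf {N : ℕ} (τ : Fin N → Fin n) :
    IsClosed {z : Fin N → ℝ | ∀ i i', τ i = τ i' → z i = z i'} := by
  have : {z : Fin N → ℝ | ∀ i i', τ i = τ i' → z i = z i'} =
      ⋂ i, ⋂ i', {z : Fin N → ℝ | τ i = τ i' → z i = z i'} := by
    ext z; simp
  rw [this]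
  refine isClosed_iInter fun i => isClosed_iInter fun i' => ?_
  by_cases h : τ i = τ i'
  · simp only [h, forall_true_left]
    exact isClosed_eq (continuous_apply i) (continuous_apply i')
  · simp [h]

/-- A closure item is a continuous image of `cl(π C) ∩ Δ_τ`. [cite: Charbonnel1991, Lemme 2.4 (iv)] -/
theorem ClItem.set_eq_image {β : ℕ → Type} (S : ∀ {e : ℕ}, β e → Set (Fin e → ℝ))
    (I : ClItem β n) :
    ClItem.set S I = (fun z : Fin I.N → ℝ => z ∘ surjInv I.hτ) ''
      (closure ((fun w : Fin I.D → ℝ => w ∘ I.ι) '' S I.C) ∩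
        {z : Fin I.N → ℝ | ∀ i i', I.τ i = I.τ i' → z i = z i'}) := by
  ext x
  simp only [ClItem.set, mem_setOf_eq, mem_image, mem_inter_iff]
  constructor
  · intro hx
    refine ⟨x ∘ I.τ, ⟨hx, fun i i' h => by simp [h]⟩, ?_⟩
    ext j
    simp [surjInv_eq I.hτ j]
  · rintro ⟨z, ⟨hz, hzΔ⟩, rfl⟩
    have : (z ∘ surjInv I.hτ) ∘ I.τ = z := by
      ext i
      exact hzΔ _ _ (surjInv_eq I.hτ (I.τ i))
    rw [this]
    exact hz

/-- **The closure step** (Charbonnel, Lemme 2.4 (ii)–(iv) and the induction step of Lemme 2.5):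
if every depth-`k` family is uniformly tame, so is every closure item with depth-`k` body.
[cite: Charbonnel1991, Lemme 2.4 and Lemme 2.5] -/
theorem ClItem.exists_forall_numCC_le
    (IH : ∀ {m' n' : ℕ} (F : NF m' k n'), ∃ N : ℕ, ∀ p : Fin m' → ℝ, numCC (F.toSet p) ≤ N)
    (I : ClItem (fun e => NF m k e) n) :
    ∃ N : ℕ, ∀ p : Fin m → ℝ,
      numCC (ClItem.set (fun {e} (C : NF m k e) => NF.toSet C p) I) ≤ N := by
  obtain ⟨Nb, hNb⟩ := IH (NF.sandwich I.ι I.τ I.C)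
  refine ⟨Nb, fun p => ?_⟩
  rw [ClItem.set_eq_image]
  refine (numCC_image_le_of_continuousOn (continuous_precompCoord _).continuousOn).trans ?_
  set B : Set (Fin I.N → ℝ) := (fun w : Fin I.D → ℝ => w ∘ I.ι) '' NF.toSet I.C p with hB
  set Λ : Set (Fin I.N → ℝ) := {z | ∀ i i', I.τ i = I.τ i' → z i = z i'} with hΛ
  refine numCC_closure_inter_le (isClosed_diagonalOf I.τ) (0 : Fin I.N → ℝ) ?_
  intro R hR δ hδ
  refine ⟨δ, hδ, le_rfl, ?_⟩
  -- the sandwich set `Y`: the `z`-projection of the sandwich family at `(p, R, δ)`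
  let G : Set (Fin (I.D + (I.N + (I.N + I.N))) → ℝ) :=
    (NF.sandwich I.ι I.τ I.C).toSet (sandParams p R δ)
  refine ⟨(fun u => fun i => u (sandZ I.D i)) '' G, ?_, ?_, ?_⟩
  · -- `K ∩ B̄(0, R) ⊆ Y`
    rintro z ⟨⟨hzcl, hzΛ⟩, hzR⟩
    rw [hB, Metric.mem_closure_iff] at hzcl
    obtain ⟨_, ⟨w, hw, rfl⟩, hdist⟩ := hzcl δ hδ
    rw [mem_closedBall, dist_zero_right] at hzR
    have hzi : ∀ i, |z i| ≤ R := fun i => by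
      have h := (norm_le_pi_norm z i).trans hzR
      rwa [Real.norm_eq_abs] at h
    have hwi : ∀ i, |z i - w (I.ι i)| < δ := fun i => by
      have := (dist_pi_lt_iff hδ).1 hdist i
      simpa [Real.dist_eq] using this
    let s : Fin I.N → ℝ := fun i => Real.sqrt (R * R - z i * z i)
    let s' : Fin I.N → ℝ := fun i => Real.sqrt (δ * δ - (z i - w (I.ι i)) * (z i - w (I.ι i)))
    let u : Fin (I.D + (I.N + (I.N + I.N))) → ℝ := Fin.append w (Fin.append z (Fin.append s s'))
    have huv : ∀ j, u (sandV I.N j) = w j := fun j => by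
      simp only [u, sandV, Fin.append_left]
    have huz : ∀ i, u (sandZ I.D i) = z i := fun i => by
      simp only [u, sandZ, Fin.append_right, Fin.append_left]
    have hus : ∀ i, u (sandS I.D i) = s i := fun i => by
      simp only [u, sandS, Fin.append_right, Fin.append_left]
    have hus' : ∀ i, u (sandS' I.D i) = s' i := fun i => by
      simp only [u, sandS', Fin.append_right]
    refine ⟨u, ?_, funext fun i => huz i⟩
    rw [NF.mem_toSet_sandwich_iff]
    refine ⟨?_, ?_, ?_, ?_⟩
    · have : u ∘ Fin.castAdd (I.N + (I.N + I.N)) = w := by ext j; simp [u]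
      rw [this]; exact hw
    · intro i i' h
      rw [huz, huz]; exact hzΛ i i' h
    · intro i
      rw [huz, hus]
      have h0 : 0 ≤ R * R - z i * z i := by
        have := hzi i
        rw [abs_le] at this
        nlinarith
      have := Real.mul_self_sqrt h0
      simp only [s]; linarith
    · intro i
      rw [huz, huv, hus']
      have h0 : 0 ≤ δ * δ - (z i - w (I.ι i)) * (z i - w (I.ι i)) := by
        have := hwi i
        rw [abs_lt] at this
        nlinarith
      have := Real.mul_self_sqrt h0
      simp only [s']; linarith
  · -- `Y ⊆ Λ ∩ B̄(0, R) ∩ B^{[δ]}`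
    rintro _ ⟨u, hu, rfl⟩
    rw [NF.mem_toSet_sandwich_iff] at hu
    obtain ⟨hw, hΔ, hball, hnear⟩ := hu
    refine ⟨⟨fun i i' h => hΔ i i' h, ?_⟩, ?_⟩
    · rw [mem_closedBall, dist_zero_right, pi_norm_le_iff_of_nonneg hR.le]
      intro i
      rw [Real.norm_eq_abs]
      have h1 : u (sandZ I.D i) * u (sandZ I.D i) ≤ R * R := by
        nlinarith [hball i, mul_self_nonneg (u (sandS I.D i))]
      have h2 : |u (sandZ I.D i)| ≤ |R| := by
        rw [← sq_le_sq]; nlinarith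
      rwa [abs_of_pos hR] at h2
    · refine mem_cthickening_of_dist_le _ ((u ∘ Fin.castAdd (I.N + (I.N + I.N))) ∘ I.ι) δ B
        ⟨_, hw, rfl⟩ ?_
      rw [dist_pi_le_iff hδ.le]
      intro i
      rw [Real.dist_eq]
      have hv : ((u ∘ Fin.castAdd (I.N + (I.N + I.N))) ∘ I.ι) i = u (sandV I.N (I.ι i)) := rfl
      rw [hv]
      have h1 : (u (sandZ I.D i) - u (sandV I.N (I.ι i))) * (u (sandZ I.D i) - u (sandV I.N (I.ι i))) ≤
          δ * δ := by
        nlinarith [hnear i, mul_self_nonneg (u (sandS' I.D i))]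
      have h2 : |u (sandZ I.D i) - u (sandV I.N (I.ι i))| ≤ |δ| := by
        rw [← sq_le_sq]; nlinarith
      rwa [abs_of_pos hδ] at h2
  · -- `cc(Y) ≤ Nb`
    refine (numCC_image_le_of_continuousOn ?_).trans (hNb _)
    exact (continuous_pi fun i => continuous_apply (sandZ I.D i)).continuousOn

end Step

/-! ### Uniform tameness of all normal forms -/

/-- Finite unions of items: the bound adds up. [folklore] -/
theorem NF.exists_forall_numCC_le_ofItems {k n : ℕ}
    (hitem : ∀ I : ClItem (fun e => NF m k e) n, ∃ N : ℕ, ∀ p : Fin m → ℝ,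
      numCC (ClItem.set (fun {e} (C : NF m k e) => NF.toSet C p) I) ≤ N) :
    ∀ L : List (ClItem (fun e => NF m k e) n), ∃ N : ℕ, ∀ p : Fin m → ℝ,
      numCC (NF.toSet (NF.ofItems L) p) ≤ N
  | [] => by
    refine ⟨0, fun p => ?_⟩
    have : NF.toSet (NF.ofItems ([] : List (ClItem (fun e => NF m k e) n))) p = ∅ := by
      ext x
      rw [NF.mem_toSet_ofItems]
      simp
    rw [this, numCC_empty]
    simp
  | I :: L => by
    obtain ⟨N₁, hN₁⟩ := hitem I
    obtain ⟨N₂, hN₂⟩ := NF.exists_forall_numCC_le_ofItems hitem L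
    refine ⟨N₁ + N₂, fun p => ?_⟩
    have : NF.toSet (NF.ofItems (I :: L)) p =
        ClItem.set (fun {e} (C : NF m k e) => NF.toSet C p) I ∪ NF.toSet (NF.ofItems L) p := by
      ext x
      rw [NF.mem_toSet_ofItems, mem_union, NF.mem_toSet_ofItems]
      simp only [List.mem_cons]
      constructor
      · rintro ⟨J, rfl | hJ, hx⟩
        · exact Or.inl hx
        · exact Or.inr ⟨J, hJ, hx⟩
      · rintro (hx | ⟨J, hJ, hx⟩)
        · exact ⟨I, Or.inl rfl, hx⟩
        · exact ⟨J, Or.inr hJ, hx⟩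
    rw [this]
    refine (numCC_union_le _ _).trans ?_
    push_cast
    exact add_le_add (hN₁ p) (hN₂ p)

/-- **Uniform tameness of the Charbonnel normal forms** (Charbonnel 1991, Lemme 2.5 for the
exponential varieties; Wilkie 1999, Thm. 2.1 / Fornasiero–Servi 2010, Thm. 7.4 for `ℝ_exp`):
for every parametric normal form `F` of any closure depth there is `N ∈ ℕ` such that `F(p)` has at
most `N` connected components for every parameter `p ∈ ℝᵐ`. [cite: Charbonnel1991, Lemme 2.5] [cite: FornasieroServi2010, Thm. 7.4] -/
theorem NF.exists_forall_numCC_le : ∀ (k : ℕ) {m n : ℕ} (F : NF m k n),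
    ∃ N : ℕ, ∀ p : Fin m → ℝ, numCC (F.toSet p) ≤ N
  | 0, _, _, t => NF.exists_forall_numCC_le_zero t
  | k + 1, _, _, L =>
    NF.exists_forall_numCC_le_ofItems
      (fun I => ClItem.exists_forall_numCC_le (fun F => NF.exists_forall_numCC_le k F) I)
      (NF.items L)

end Tameness

end Literature.ModelTheory.ExponentialFields
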